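import Mathlib.Analysis.ODE.Gronwall
import Mathlib.Analysis.Calculus.ContDiff.RCLike
import Mathlib.Analysis.Calculus.MeanValue
import Mathlib.Topology.MetricSpace.Pseudo.Lemmas
import Literature.Analysis.ODE.GlobalExistence
import HarnessLib

/-!
# Smooth dependence on initial conditions, within a convex set

Trunk: analysis / ODE (serving `Literature/Topology/FourManifolds/ProductCobordism.lean`, the flow
input of Milnor's product theorem `Literature.Topology.FourManifolds.Cobordism.isTrivial_of_isMorseFunction`).

Mathlib (this pin) has the local Picard–Lindelöf theorem with Lipschitz-continuous dependence on
the initial value (`IsPicardLindelof.exists_forall_mem_closedBall_eq_hasDerivWithinAt_continuousOn`)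
and Grönwall's inequality (`dist_le_of_approx_trajectories_ODE_of_mem`), but no *differentiable*
dependence of solutions on the initial value.  This file proves the classical theorem
(Lang 1995, Ch. IV §1, Thm. 1.14 and Thm. 1.16; Hartman 1964, Ch. V, Thm. 3.1; Hirsch 1976,
§6.2) in the form needed for manifolds **with boundary** in Mathlib's formalism, where charts take
values in a closed half-space and smoothness means `ContDiffOn` on that (convex) set: all
hypotheses and conclusions are *within* a convex set `S` on which the field `F` is `C^k`
(`ContDiffOn ℝ k F S`, derivatives `fderivWithin ℝ F S`), and no extension of `F` to an open
set is used.  The solutions are *given* (a family of exact solutions staying in `S`); existence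
is a separate matter (Picard–Lindelöf).

## Main results (all proved)

* `Literature.ODE.IsSolutionFamily F S A T u`: `u y` solves `u' = F (u)` on `[0, T]` with `u y 0 = y`
  and values in `S`, for every `y ∈ A` (closed-interval convention of Mathlib's Picard–Lindelöf:
  `HasDerivWithinAt _ _ (Icc 0 T) t`).
* `IsSolutionFamily.dist_le_of_lipschitzOnWith_ball` — Lipschitz dependence on the initial
  value with a tube estimate (Grönwall; Lang 1995, IV §1, Cor. 1.2).
* `Literature.Analysis.ODE.exists_solution_linear`, `norm_le_of_linear`, `norm_sub_le_of_linear` — the linearised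
  equation `J' = A(t) ∘ J` in `E →L[ℝ] E`: global existence on `[0, T]`, exponential bound,
  Grönwall comparison (continuous dependence on the coefficient).
* `IsSolutionFamily.hasFDerivWithinAt` — **the variational equation**: `y ↦ u y τ` has derivative
  `J τ` within `A`, where `J' = DF (u y t) ∘ J`, `J 0 = id` (Lang 1995, IV §1, Thm. 1.14 and
  formula (5), p. 70).
* `IsSolutionFamily.contDiffOn` — **`C^n` dependence on the initial value**, `1 ≤ n ≤ ∞`, by
  induction on `n` through the extended system `(x, B) ↦ (F x, DF x ∘ B)` on `S × (E →L E)`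
  (Lang 1995, IV §1, proof of Thm. 1.14, p. 70).
* `Literature.ODE.IsFlowWithin F S φ Ω` and `IsFlowWithin.contDiffOn` — **a flow within `S` is `C^n`
  jointly in `(x, t)` on its domain `Ω ⊆ E × ℝ`** (Lang 1995, IV §1, Thm. 1.16), reduced to the
  previous result by rescaling time (`s ↦ φ x (t s)` solves `u' = t F (u)` on `[0, 1]`).

Auxiliary: uniform continuity of a `ContinuousOn` function *at* a compact subset, and a uniform
Lipschitz constant for a `C¹` function near a compact subset of a convex set
(`exists_forall_dist_lt_of_isCompact`, `exists_lipschitzOnWith_ball_of_isCompact`).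

## References

* S. Lang, *Differential and Riemannian Manifolds*, GTM 160, Springer (1995), Ch. IV §1,
  Prop. 1.1, Cor. 1.2, Lemma 1.12–1.13, Thm. 1.14, Lemma 1.15, Thm. 1.16 (PDF pp. 62–71).
* P. Hartman, *Ordinary Differential Equations*, Wiley (1964), Ch. V, Thm. 3.1, Cor. 3.1.
* M. W. Hirsch, *Differential Topology*, GTM 33, Springer (1976), Ch. 6 §2 (flows of `C^r`
  vector fields are `C^r`; vector fields on `∂`-manifolds).
* G. Teschl, *Ordinary Differential Equations and Dynamical Systems*, GSM 140, AMS (2012),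
  Thm. 2.10 (smooth dependence), §2.4.
-/

open Set Metric Filter Topology Asymptotics
open scoped NNReal ContDiff

noncomputable section

namespace Literature.Analysis.ODE

/-! ## Uniform estimates near a compact set -/

section Uniform

variable {α β : Type*} [PseudoMetricSpace α] [PseudoMetricSpace β]

/-- A function continuous on `S` is uniformly continuous *at* a compact subset `K ⊆ S`: `f q` is
close to `f p` whenever `p ∈ K`, `q ∈ S` and `q` is close to `p` (the `ContinuousOn` version of
Mathlib's `IsCompact.uniformContinuousAt_of_continuousAt`; used as in Lang 1995, IV §1, proof of
Lemma 1.12: "as in the case of uniform continuity"). [folklore] -/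
theorem exists_forall_dist_lt_of_isCompact {f : α → β} {S K : Set α} (hf : ContinuousOn f S)
    (hK : IsCompact K) (hKS : K ⊆ S) {ε : ℝ} (hε : 0 < ε) :
    ∃ δ > 0, ∀ p ∈ K, ∀ q ∈ S, dist q p < δ → dist (f q) (f p) < ε := by
  -- local radii from continuity within `S`
  have hloc : ∀ p ∈ K, ∃ r > 0, ∀ q ∈ S, dist q p < r → dist (f q) (f p) < ε / 2 := by
    intro p hp
    have h := Metric.continuousWithinAt_iff.mp (hf p (hKS hp)) (ε / 2) (half_pos hε)
    obtain ⟨r, hr, h⟩ := h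
    exact ⟨r, hr, fun q hq hqp => h hq hqp⟩
  choose! r hr hball using hloc
  -- finite subcover of `K` by the balls `ball p (r p / 2)`
  obtain ⟨t, htK, htfin, hcover⟩ :=
    hK.elim_finite_subcover_image (b := K) (c := fun p => ball p (r p / 2))
      (fun p _ => isOpen_ball)
      (fun p hp => mem_iUnion₂.mpr ⟨p, hp, mem_ball_self (half_pos (hr p hp))⟩)
  rcases t.eq_empty_or_nonempty with rfl | hne
  · -- `K` is empty
    refine ⟨1, one_pos, fun p hp => ?_⟩
    have : p ∈ (∅ : Set α) := by simpa using hcover hp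
    exact absurd this (notMem_empty p)
  obtain ⟨δ, hδpos, hδle⟩ : ∃ δ > 0, ∀ p ∈ t, δ ≤ r p / 2 := by
    have hfin' : (htfin.image fun p => r p / 2).toFinset.Nonempty := by
      simpa using hne.image (fun p => r p / 2)
    refine ⟨(htfin.image fun p => r p / 2).toFinset.min' hfin', ?_, ?_⟩
    · have hmem := (htfin.image fun p => r p / 2).toFinset.min'_mem hfin'
      simp only [Finite.mem_toFinset, mem_image] at hmem
      obtain ⟨p, hp, hpeq⟩ := hmem
      rw [← hpeq]
      exact half_pos (hr p (htK hp))
    · intro p hp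
      apply Finset.min'_le
      simp only [Finite.mem_toFinset, mem_image]
      exact ⟨p, hp, rfl⟩
  refine ⟨δ, hδpos, fun p hp q hq hqp => ?_⟩
  obtain ⟨i, hi, hpi⟩ := mem_iUnion₂.mp (hcover hp)
  have hri := hr i (htK hi)
  have h1 : dist (f p) (f i) < ε / 2 :=
    hball i (htK hi) p (hKS hp) (lt_of_lt_of_le (mem_ball.mp hpi) (by linarith))
  have h2 : dist (f q) (f i) < ε / 2 := by
    apply hball i (htK hi) q hq
    calc dist q i ≤ dist q p + dist p i := dist_triangle _ _ _
      _ < δ + r i / 2 := add_lt_add hqp (mem_ball.mp hpi)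
      _ ≤ r i / 2 + r i / 2 := by linarith [hδle i hi]
      _ = r i := by ring
  calc dist (f q) (f p) ≤ dist (f q) (f i) + dist (f p) (f i) := dist_triangle_right _ _ _
    _ < ε / 2 + ε / 2 := add_lt_add h2 h1
    _ = ε := by ring

end Uniform

section Lipschitz

variable {E F : Type*} [NormedAddCommGroup E] [NormedSpace ℝ E] [NormedAddCommGroup F]
  [NormedSpace ℝ F]

/-- A `C¹` function on a convex set `S` is Lipschitz, with one constant and one radius, on the
traces on `S` of all balls centred on a compact subset `K ⊆ S` (Mathlib
`ContDiffWithinAt.exists_lipschitzOnWith` plus a Lebesgue-number argument; Lang 1995, IV §1,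
"locally `f` satisfies Lipschitz conditions"). [folklore] -/
theorem exists_lipschitzOnWith_ball_of_isCompact {f : E → F} {S K : Set E} (hS : Convex ℝ S)
    (hf : ContDiffOn ℝ 1 f S) (hK : IsCompact K) (hKS : K ⊆ S) :
    ∃ C : ℝ≥0, ∃ r > 0, ∀ p ∈ K, LipschitzOnWith C f (S ∩ ball p r) := by
  have hloc : ∀ p ∈ K, ∃ C : ℝ≥0, ∃ r > 0, LipschitzOnWith C f (S ∩ ball p r) := by
    intro p hp
    obtain ⟨C, t, ht, hCt⟩ := (hf p (hKS hp)).exists_lipschitzOnWith hS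
    obtain ⟨r, hr, hsub⟩ := Metric.mem_nhdsWithin_iff.mp ht
    exact ⟨C, r, hr, hCt.mono (by rwa [inter_comm] at hsub)⟩
  choose! C r hr hlip using hloc
  obtain ⟨t, htK, htfin, hcover⟩ :=
    hK.elim_finite_subcover_image (b := K) (c := fun p => ball p (r p / 2))
      (fun p _ => isOpen_ball)
      (fun p hp => mem_iUnion₂.mpr ⟨p, hp, mem_ball_self (half_pos (hr p hp))⟩)
  rcases t.eq_empty_or_nonempty with rfl | hne
  · refine ⟨0, 1, one_pos, fun p hp => ?_⟩
    have : p ∈ (∅ : Set E) := by simpa using hcover hp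
    exact absurd this (notMem_empty p)
  obtain ⟨δ, hδpos, hδle⟩ : ∃ δ > 0, ∀ p ∈ t, δ ≤ r p / 2 := by
    have hfin' : (htfin.image fun p => r p / 2).toFinset.Nonempty := by
      simpa using hne.image (fun p => r p / 2)
    refine ⟨(htfin.image fun p => r p / 2).toFinset.min' hfin', ?_, ?_⟩
    · have hmem := (htfin.image fun p => r p / 2).toFinset.min'_mem hfin'
      simp only [Finite.mem_toFinset, mem_image] at hmem
      obtain ⟨p, hp, hpeq⟩ := hmem
      rw [← hpeq]
      exact half_pos (hr p (htK hp))
    · intro p hp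
      apply Finset.min'_le
      simp only [Finite.mem_toFinset, mem_image]
      exact ⟨p, hp, rfl⟩
  obtain ⟨Cmax, hCmax⟩ : ∃ Cmax : ℝ≥0, ∀ p ∈ t, C p ≤ Cmax := by
    refine ⟨(htfin.image C).toFinset.sup id, fun p hp => ?_⟩
    exact Finset.le_sup (f := id)
      (by simp only [Finite.mem_toFinset, mem_image]; exact ⟨p, hp, rfl⟩)
  refine ⟨Cmax, δ, hδpos, fun p hp => ?_⟩
  obtain ⟨i, hi, hpi⟩ := mem_iUnion₂.mp (hcover hp)
  have hsub : S ∩ ball p δ ⊆ S ∩ ball i (r i) := by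
    rintro q ⟨hqS, hq⟩
    refine ⟨hqS, ?_⟩
    rw [mem_ball] at hq hpi ⊢
    calc dist q i ≤ dist q p + dist p i := dist_triangle _ _ _
      _ < δ + r i / 2 := add_lt_add hq hpi
      _ ≤ r i / 2 + r i / 2 := by linarith [hδle i hi]
      _ = r i := by ring
  exact ((hlip i (htK hi)).mono hsub).weaken (hCmax i hi)

end Lipschitz

/-! ## Grönwall bookkeeping -/

/-- `gronwallBound 0 K ε x` is linear in `ε` (from the closed formulas
`gronwallBound_K0`, `gronwallBound_of_K_ne_0`). [folklore] -/
theorem gronwallBound_zero_mul (K ε c x : ℝ) :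
    gronwallBound 0 K (c * ε) x = c * gronwallBound 0 K ε x := by
  by_cases hK : K = 0
  · subst hK; simp only [gronwallBound_K0]; ring
  · simp only [gronwallBound_of_K_ne_0 hK]; ring

/-! ## The linearised equation `J' = A(t) ∘ J` -/

section LinearSec

variable {E : Type*} [NormedAddCommGroup E] [NormedSpace ℝ E]


/-- **A priori bound for the linearised equation.** A solution of `J' = A(t) ∘ J` on `[a, s]`
with `‖A t‖ ≤ M` satisfies `‖J t‖ ≤ ‖J a‖ exp (M (t - a))` (Grönwall; Hartman 1964, Ch. IV,
Lemma 4.1; Teschl 2012, §2.4). [folklore] -/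
theorem norm_le_of_linear {A : ℝ → E →L[ℝ] E} {a s : ℝ} {M : ℝ} {J : ℝ → E →L[ℝ] E}
    (hJ : ∀ t ∈ Icc a s, HasDerivWithinAt J ((A t).comp (J t)) (Icc a s) t)
    (hM : ∀ t ∈ Ico a s, ‖A t‖ ≤ M) :
    ∀ t ∈ Icc a s, ‖J t‖ ≤ ‖J a‖ * Real.exp (M * (t - a)) := by
  intro t ht
  rcases lt_or_ge a s with has | hsa
  · have hcont : ContinuousOn J (Icc a s) := fun τ hτ => (hJ τ hτ).continuousWithinAt
    have hder : ∀ τ ∈ Ico a s, HasDerivWithinAt J ((A τ).comp (J τ)) (Ici τ) τ := fun τ hτ =>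
      (hJ τ (Ico_subset_Icc_self hτ)).mono_of_mem_nhdsWithin
        (mem_of_superset (Icc_mem_nhdsGE hτ.2) (Icc_subset_Icc hτ.1 le_rfl))
    have hbound : ∀ τ ∈ Ico a s, ‖(A τ).comp (J τ)‖ ≤ M * ‖J τ‖ + 0 := fun τ hτ => by
      rw [add_zero]
      exact ((A τ).opNorm_comp_le (J τ)).trans
        (mul_le_mul_of_nonneg_right (hM τ hτ) (norm_nonneg _))
    have := norm_le_gronwallBound_of_norm_deriv_right_le hcont hder le_rfl hbound t ht
    rwa [gronwallBound_ε0] at this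
  · have hta : t = a := le_antisymm (ht.2.trans hsa) ht.1
    subst hta
    simp

variable [CompleteSpace E]

/-- **The linearised equation has global solutions.** For `A : ℝ → (E →L E)` continuous on
`[0, T]` and any initial value `B₀`, the linear equation `J' = A(t) ∘ J` has a solution on
`[0, T]` with `J 0 = B₀` (Picard–Lindelöf steps continued with the exponential a priori bound of
`norm_le_of_linear`, via `Literature.Analysis.ODE.solution_extend`; Hartman 1964, Ch. IV, Lemma 1.1: linear
systems with continuous coefficients have solutions on the whole interval; Lang 1995, IV §1,
Prop. 1.9). [cite: Lang1995, Ch. IV §1, Prop. 1.9] -/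
theorem exists_solution_linear {A : ℝ → E →L[ℝ] E} {T : ℝ} (hT : 0 ≤ T)
    (hA : ContinuousOn A (Icc 0 T)) (B₀ : E →L[ℝ] E) :
    ∃ J : ℝ → E →L[ℝ] E, J 0 = B₀ ∧
      ∀ t ∈ Icc 0 T, HasDerivWithinAt J ((A t).comp (J t)) (Icc 0 T) t := by
  obtain ⟨M₀, hM'⟩ := isCompact_Icc.exists_bound_of_continuousOn hA
  have hM0 : 0 ≤ M₀ := (norm_nonneg _).trans (hM' 0 (left_mem_Icc.mpr hT))
  lift M₀ to ℝ≥0 using hM0 with M hM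
  set R : ℝ := ‖B₀‖ * Real.exp (M * T) with hR
  have hR0 : 0 ≤ R := by positivity
  set v : ℝ → (E →L[ℝ] E) → (E →L[ℝ] E) := fun t B => (A t).comp B with hv
  have hlip : ∀ t ∈ Icc 0 T, LipschitzOnWith M (v t) (closedBall 0 (R + 1)) := by
    intro t ht
    refine LipschitzOnWith.of_dist_le_mul fun x _ y _ => ?_
    rw [dist_eq_norm, dist_eq_norm, hv]
    dsimp only
    rw [← ContinuousLinearMap.comp_sub]
    exact ((A t).opNorm_comp_le _).trans (mul_le_mul_of_nonneg_right (hM' t ht) (norm_nonneg _))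
  have hcont : ∀ x ∈ closedBall (0 : E →L[ℝ] E) (R + 1), ContinuousOn (v · x) (Icc 0 T) := by
    intro x _
    exact ((ContinuousLinearMap.compL ℝ E E E).flip x).continuous.comp_continuousOn hA
  have hbdd : ∀ t ∈ Icc 0 T, ∀ x ∈ closedBall (0 : E →L[ℝ] E) (R + 1),
      ‖v t x‖ ≤ (⟨M * (R + 1), by positivity⟩ : ℝ≥0) := by
    intro t ht x hx
    have hx' : ‖x‖ ≤ R + 1 := by simpa using hx
    calc ‖(A t).comp x‖ ≤ ‖A t‖ * ‖x‖ := (A t).opNorm_comp_le x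
      _ ≤ M * (R + 1) := mul_le_mul (hM' t ht) hx' (norm_nonneg _) M.coe_nonneg
  have hα : ∀ t ∈ Icc (0 : ℝ) 0, HasDerivWithinAt (fun _ : ℝ => B₀) (v t B₀) (Icc 0 0) t :=
    solution_const v 0 B₀
  have hapriori : ∀ s ∈ Icc (0 : ℝ) T, ∀ β : ℝ → E →L[ℝ] E,
      (∀ t ∈ Icc 0 s, HasDerivWithinAt β (v t (β t)) (Icc 0 s) t) →
      EqOn β (fun _ => B₀) (Icc 0 0) → ∀ t ∈ Icc 0 s, ‖β t‖ ≤ R := by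
    intro s hs β hβ hβ0 t ht
    have h0 : β 0 = B₀ := hβ0 (left_mem_Icc.mpr le_rfl)
    have := norm_le_of_linear (A := A) hβ (fun τ hτ => hM' τ ⟨hτ.1, hτ.2.le.trans hs.2⟩) t ht
    rw [h0, sub_zero] at this
    refine this.trans ?_
    rw [hR]
    gcongr
    exact ht.2.trans hs.2
  obtain ⟨J, hJ, hJ0⟩ := solution_extend le_rfl hT hα hlip hcont hbdd hapriori
  exact ⟨J, hJ0 (left_mem_Icc.mpr le_rfl), hJ⟩

omit [CompleteSpace E] in
/-- **Grönwall comparison for linearised equations.** Solutions of `J₁' = A₁ ∘ J₁`,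
`J₂' = A₂ ∘ J₂` on `[0, T]` with `‖A₁ t‖ ≤ M`, `‖A₁ t - A₂ t‖ ≤ η` and `‖J₂ t‖ ≤ P` satisfy
`‖J₁ t - J₂ t‖ ≤ gronwallBound ‖J₁ 0 - J₂ 0‖ M (η P) t`: they depend Lipschitz-continuously on
the initial value and on the coefficients (Mathlib `dist_le_of_approx_trajectories_ODE_of_mem`,
`J₂` being an `η P`-approximate solution of the first equation). [folklore] -/
theorem norm_sub_le_of_linear {A₁ A₂ : ℝ → E →L[ℝ] E} {T M η P : ℝ} {J₁ J₂ : ℝ → E →L[ℝ] E}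
    (hJ₁ : ∀ t ∈ Icc 0 T, HasDerivWithinAt J₁ ((A₁ t).comp (J₁ t)) (Icc 0 T) t)
    (hJ₂ : ∀ t ∈ Icc 0 T, HasDerivWithinAt J₂ ((A₂ t).comp (J₂ t)) (Icc 0 T) t)
    (hM : ∀ t ∈ Ico 0 T, ‖A₁ t‖ ≤ M) (hη : ∀ t ∈ Ico 0 T, ‖A₁ t - A₂ t‖ ≤ η)
    (hP : ∀ t ∈ Ico 0 T, ‖J₂ t‖ ≤ P) (hη0 : 0 ≤ η) :
    ∀ t ∈ Icc 0 T, ‖J₁ t - J₂ t‖ ≤ gronwallBound ‖J₁ 0 - J₂ 0‖ M (η * P) (t - 0) := by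
  intro t ht
  rcases lt_or_ge 0 T with hT | hT
  · have hMnn : 0 ≤ M := (norm_nonneg _).trans (hM 0 ⟨le_rfl, hT⟩)
    lift M to ℝ≥0 using hMnn with M' hM'
    have key := dist_le_of_approx_trajectories_ODE_of_mem
      (v := fun t x => (A₁ t).comp x) (s := fun _ => univ) (K := M')
      (f := J₁) (g := J₂) (f' := fun t => (A₁ t).comp (J₁ t)) (g' := fun t => (A₂ t).comp (J₂ t))
      (a := 0) (b := T) (εf := 0) (εg := η * P) (δ := ‖J₁ 0 - J₂ 0‖)
      (fun τ hτ => by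
        refine LipschitzOnWith.of_dist_le_mul fun x _ y _ => ?_
        rw [dist_eq_norm, dist_eq_norm, ← ContinuousLinearMap.comp_sub]
        exact ((A₁ τ).opNorm_comp_le _).trans
          (mul_le_mul_of_nonneg_right (hM τ hτ) (norm_nonneg _)))
      (fun τ hτ => (hJ₁ τ hτ).continuousWithinAt)
      (fun τ hτ => (hJ₁ τ (Ico_subset_Icc_self hτ)).mono_of_mem_nhdsWithin
        (mem_of_superset (Icc_mem_nhdsGE hτ.2) (Icc_subset_Icc hτ.1 le_rfl)))
      (fun τ hτ => by simp)
      (fun τ hτ => mem_univ _)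
      (fun τ hτ => (hJ₂ τ hτ).continuousWithinAt)
      (fun τ hτ => (hJ₂ τ (Ico_subset_Icc_self hτ)).mono_of_mem_nhdsWithin
        (mem_of_superset (Icc_mem_nhdsGE hτ.2) (Icc_subset_Icc hτ.1 le_rfl)))
      (fun τ hτ => by
        rw [dist_eq_norm]
        calc ‖(A₂ τ).comp (J₂ τ) - (A₁ τ).comp (J₂ τ)‖ = ‖(A₁ τ - A₂ τ).comp (J₂ τ)‖ := by
              rw [ContinuousLinearMap.sub_comp, norm_sub_rev]
          _ ≤ ‖A₁ τ - A₂ τ‖ * ‖J₂ τ‖ := (A₁ τ - A₂ τ).opNorm_comp_le _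
          _ ≤ η * P := mul_le_mul (hη τ hτ) (hP τ hτ) (norm_nonneg _) hη0)
      (fun τ hτ => mem_univ _)
      (by rw [dist_eq_norm]) t ht
    rwa [dist_eq_norm, zero_add] at key
  · have ht0 : t = 0 := le_antisymm (ht.2.trans hT) ht.1
    subst ht0
    simp [gronwallBound_x0]


end LinearSec

/-! ## Families of solutions indexed by the initial value -/

section Family

universe u

variable {E : Type u} [NormedAddCommGroup E] [NormedSpace ℝ E]

/-- A family `u` of solutions of the autonomous equation `u' = F (u)` on the time interval
`[0, T]`, indexed by their initial values `y ∈ A`, all of whose values lie in the set `S`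
(solutions in the closed-interval convention of Mathlib's Picard–Lindelöf theorem: one-sided
derivatives at the endpoints; Lang 1995, IV §1, the local flow `α : J × U₀ → U` of Prop. 1.1,
restricted to `t ≥ 0`). [cite: Lang1995, Ch. IV §1, Prop. 1.1] -/
structure IsSolutionFamily (F : E → E) (S A : Set E) (T : ℝ) (u : E → ℝ → E) : Prop where
  init : ∀ y ∈ A, u y 0 = y
  hasDerivWithinAt : ∀ y ∈ A, ∀ τ ∈ Icc 0 T, HasDerivWithinAt (u y) (F (u y τ)) (Icc 0 T) τ
  mem : ∀ y ∈ A, ∀ τ ∈ Icc 0 T, u y τ ∈ S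

namespace IsSolutionFamily

variable {F : E → E} {S A : Set E} {T : ℝ} {u : E → ℝ → E}

/-- Members of a solution family are continuous on `[0, T]`. [folklore] -/
theorem continuousOn (h : IsSolutionFamily F S A T u) {y : E} (hy : y ∈ A) :
    ContinuousOn (u y) (Icc 0 T) :=
  fun τ hτ => (h.hasDerivWithinAt y hy τ hτ).continuousWithinAt

/-- Right derivatives of members of a solution family on `[0, T)`. [folklore] -/
theorem hasDerivWithinAt_Ici (h : IsSolutionFamily F S A T u) {y : E} (hy : y ∈ A) {τ : ℝ}
    (hτ : τ ∈ Ico 0 T) : HasDerivWithinAt (u y) (F (u y τ)) (Ici τ) τ :=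
  (h.hasDerivWithinAt y hy τ (Ico_subset_Icc_self hτ)).mono_of_mem_nhdsWithin
    (mem_of_superset (Icc_mem_nhdsGE hτ.2) (Icc_subset_Icc hτ.1 le_rfl))

/-- Restriction of a solution family to a shorter time interval `[0, T']`, `T' ≤ T`. [folklore] -/
theorem mono_time (h : IsSolutionFamily F S A T u) {T' : ℝ} (hT' : T' ≤ T) :
    IsSolutionFamily F S A T' u where
  init := h.init
  hasDerivWithinAt y hy τ hτ :=
    (h.hasDerivWithinAt y hy τ ⟨hτ.1, hτ.2.trans hT'⟩).mono (Icc_subset_Icc le_rfl hT')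
  mem y hy τ hτ := h.mem y hy τ ⟨hτ.1, hτ.2.trans hT'⟩

/-- Restriction of a solution family to a smaller set of initial values. [folklore] -/
theorem mono_set (h : IsSolutionFamily F S A T u) {A' : Set E} (hA' : A' ⊆ A) :
    IsSolutionFamily F S A' T u where
  init y hy := h.init y (hA' hy)
  hasDerivWithinAt y hy := h.hasDerivWithinAt y (hA' hy)
  mem y hy := h.mem y (hA' hy)

/-- The trajectory `u y '' [0, T]` of a member of the family is compact. [folklore] -/
theorem isCompact_image (h : IsSolutionFamily F S A T u) {y : E} (hy : y ∈ A) :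
    IsCompact (u y '' Icc 0 T) :=
  isCompact_Icc.image_of_continuousOn (h.continuousOn hy)

/-- The trajectory `u y '' [0, T]` of a member of the family lies in `S`. [folklore] -/
theorem image_subset (h : IsSolutionFamily F S A T u) {y : E} (hy : y ∈ A) :
    u y '' Icc 0 T ⊆ S := by
  rintro _ ⟨τ, hτ, rfl⟩; exact h.mem y hy τ hτ

/-- **Grönwall in a tube.** If `F` is `K`-Lipschitz on `S ∩ ball p r` for every point `p` of the
trajectory of `y`, and the trajectory of `y'` stays `r`-close to it on `[0, T)`, then the
distance of the two trajectories grows at most like `exp (K t)` (Mathlib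
`dist_le_of_trajectories_ODE_of_mem` with the time-dependent sets `S ∩ ball (u y t) r`). [folklore] -/
theorem dist_le_of_mem_ball (h : IsSolutionFamily F S A T u) {K : ℝ≥0} {r : ℝ} {y y' : E}
    (hy : y ∈ A) (hy' : y' ∈ A)
    (hlip : ∀ τ ∈ Ico 0 T, LipschitzOnWith K F (S ∩ ball (u y τ) r))
    (hclose : ∀ τ ∈ Ico 0 T, dist (u y' τ) (u y τ) < r) :
    ∀ τ ∈ Icc 0 T, dist (u y' τ) (u y τ) ≤ dist y' y * Real.exp (K * τ) := by
  intro τ hτ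
  have hr : ∀ σ ∈ Ico 0 T, 0 < r := fun σ hσ => lt_of_le_of_lt dist_nonneg (hclose σ hσ)
  have := dist_le_of_trajectories_ODE_of_mem (v := fun _ => F) (s := fun σ => S ∩ ball (u y σ) r)
    (f := u y') (g := u y) (a := 0) (b := T) (δ := dist y' y) hlip
    (h.continuousOn hy') (fun σ hσ => h.hasDerivWithinAt_Ici hy' hσ)
    (fun σ hσ => ⟨h.mem y' hy' σ (Ico_subset_Icc_self hσ), hclose σ hσ⟩)
    (h.continuousOn hy) (fun σ hσ => h.hasDerivWithinAt_Ici hy hσ)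
    (fun σ hσ => ⟨h.mem y hy σ (Ico_subset_Icc_self hσ), mem_ball_self (hr σ hσ)⟩)
    (by rw [h.init y hy, h.init y' hy']) τ hτ
  simpa using this

/-- **Lipschitz dependence on the initial value, with a tube estimate.**  If `F` is `K`-Lipschitz
on `S ∩ ball p r` for every point `p` of the trajectory of `y ∈ A`, then every trajectory of
the family starting within distance `r exp (-K T) / 2` of `y` stays in the tube of radius `r`
around the trajectory of `y` and satisfies `dist (u y' τ) (u y τ) ≤ exp (K T) dist y' y`
(first-exit-time argument plus Grönwall; Lang 1995, IV §1, Cor. 1.2: continuity of the local flow,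
with the Lipschitz estimate of its proof). [cite: Lang1995, Ch. IV §1, Cor. 1.2] -/
theorem dist_le_of_lipschitzOnWith_ball (h : IsSolutionFamily F S A T u)
    {K : ℝ≥0} {r : ℝ} (hr : 0 < r) {y : E} (hy : y ∈ A)
    (hlip : ∀ τ ∈ Icc 0 T, LipschitzOnWith K F (S ∩ ball (u y τ) r)) {y' : E} (hy' : y' ∈ A)
    (hclose : dist y' y < r * Real.exp (-(K * T)) / 2) :
    ∀ τ ∈ Icc 0 T, dist (u y' τ) (u y τ) < r ∧
      dist (u y' τ) (u y τ) ≤ dist y' y * Real.exp (K * T) := by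
  -- first, the tube property on all of `[0, T]`, by a continuity (first exit time) argument
  have hexpT : 0 < Real.exp (K * T) := Real.exp_pos _
  have hdist_small : dist y' y * Real.exp (K * T) < r := by
    have h1 : dist y' y * Real.exp (K * T) < r * Real.exp (-(K * T)) / 2 * Real.exp (K * T) :=
      mul_lt_mul_of_pos_right hclose hexpT
    have h2 : r * Real.exp (-(K * T)) / 2 * Real.exp (K * T) = r / 2 := by
      rw [Real.exp_neg]; field_simp
    rw [h2] at h1
    linarith
  have htube : ∀ τ ∈ Icc 0 T, dist (u y' τ) (u y τ) < r := by
    by_contra hbad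
    push Not at hbad
    -- the set of bad times is closed and nonempty; take its infimum
    set B : Set ℝ := Icc 0 T ∩ {σ | r ≤ dist (u y' σ) (u y σ)} with hB
    have hBne : B.Nonempty := by
      obtain ⟨σ, hσ, hσr⟩ := hbad; exact ⟨σ, hσ, hσr⟩
    have hcont : ContinuousOn (fun σ => dist (u y' σ) (u y σ)) (Icc 0 T) :=
      continuous_dist.comp_continuousOn ((h.continuousOn hy').prodMk (h.continuousOn hy))
    have hBclosed : IsClosed B :=
      hcont.preimage_isClosed_of_isClosed isClosed_Icc isClosed_Ici
    have hBbdd : BddBelow B := ⟨0, fun σ hσ => hσ.1.1⟩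
    set τ₁ := sInf B with hτ₁
    have hτ₁B : τ₁ ∈ B := hBclosed.csInf_mem hBne hBbdd
    have hτ₁T : τ₁ ≤ T := hτ₁B.1.2
    have hτ₁0 : 0 ≤ τ₁ := hτ₁B.1.1
    -- before `τ₁` the trajectories are `r`-close
    have hbefore : ∀ σ ∈ Ico 0 τ₁, dist (u y' σ) (u y σ) < r := by
      intro σ hσ
      by_contra hge
      push Not at hge
      have hσB : σ ∈ B := ⟨⟨hσ.1, hσ.2.le.trans hτ₁T⟩, hge⟩
      exact absurd (csInf_le hBbdd hσB) (not_le.mpr hσ.2)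
    -- Grönwall on `[0, τ₁]`
    have h' := h.mono_time hτ₁T
    have hest := h'.dist_le_of_mem_ball hy hy'
      (fun σ hσ => hlip σ ⟨hσ.1, hσ.2.le.trans hτ₁T⟩) hbefore τ₁ ⟨hτ₁0, le_rfl⟩
    have hle : dist y' y * Real.exp (K * τ₁) ≤ dist y' y * Real.exp (K * T) :=
      mul_le_mul_of_nonneg_left (Real.exp_le_exp.mpr
        (mul_le_mul_of_nonneg_left hτ₁T K.coe_nonneg)) dist_nonneg
    exact absurd (hτ₁B.2.trans (hest.trans hle)) (not_le.mpr hdist_small)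
  intro τ hτ
  refine ⟨htube τ hτ, ?_⟩
  have hest := h.dist_le_of_mem_ball hy hy' (fun σ hσ => hlip σ (Ico_subset_Icc_self hσ))
    (fun σ hσ => htube σ (Ico_subset_Icc_self hσ)) τ hτ
  refine hest.trans (mul_le_mul_of_nonneg_left (Real.exp_le_exp.mpr ?_) dist_nonneg)
  exact mul_le_mul_of_nonneg_left hτ.2 K.coe_nonneg


/-- **Differentiability of the solution in the initial value** (the variational equation).
Let `u` be a family of solutions of `u' = F (u)` on `[0, T]` with values in the convex set `S`,
on which `F` is `C¹`, and let `J` solve the linearised equation `J' = DF (u y t) ∘ J`,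
`J 0 = id`, along the trajectory of `y ∈ A`. Then for every `τ ∈ [0, T]` the map
`y' ↦ u y' τ` has derivative `J τ` at `y` within `A`.  Proof: the error
`e = u y' - u y - J (y' - y)` satisfies `e 0 = 0`, `‖e'‖ ≤ M ‖e‖ + o(‖y' - y‖)` by the uniform
differentiability of `F` near the compact trajectory (mean value inequality on the convex sets
`S ∩ ball p ρ`) and the Lipschitz estimate, then Grönwall (Lang 1995, IV §1, Thm. 1.14 with
the variational equation (5), p. 70: `D₁D₂α = Df(α) D₂α`; Hartman 1964, Ch. V, Thm. 3.1). [cite: Lang1995, Ch. IV §1, Thm. 1.14] -/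
theorem hasFDerivWithinAt (h : IsSolutionFamily F S A T u) (hT : 0 ≤ T) (hS : Convex ℝ S)
    (hSu : UniqueDiffOn ℝ S) (hF : ContDiffOn ℝ 1 F S) {y : E} (hy : y ∈ A)
    {J : ℝ → E →L[ℝ] E} (hJ0 : J 0 = 1)
    (hJ : ∀ t ∈ Icc 0 T,
      HasDerivWithinAt J ((fderivWithin ℝ F S (u y t)).comp (J t)) (Icc 0 T) t)
    {τ : ℝ} (hτ : τ ∈ Icc 0 T) :
    HasFDerivWithinAt (fun y' => u y' τ) (J τ) A y := by
  set F' : E → E →L[ℝ] E := fderivWithin ℝ F S with hF'def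
  have hF'cont : ContinuousOn F' S := hF.continuousOn_fderivWithin hSu le_rfl
  have hFdiff : ∀ p ∈ S, HasFDerivWithinAt F (F' p) S p := fun p hp =>
    ((hF.differentiableOn one_ne_zero) p hp).hasFDerivWithinAt
  -- the compact trajectory `Γ` of `y`
  set Γ : Set E := u y '' Icc 0 T with hΓ
  have hΓc : IsCompact Γ := h.isCompact_image hy
  have hΓS : Γ ⊆ S := h.image_subset hy
  -- (i) uniform Lipschitz constant of `F` near `Γ`
  obtain ⟨K, r₁, hr₁, hlip⟩ := exists_lipschitzOnWith_ball_of_isCompact hS hF hΓc hΓS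
  -- bounds on `F' ∘ u y` and on `J` along `[0, T]`
  have hJcont : ContinuousOn J (Icc 0 T) := fun t ht => (hJ t ht).continuousWithinAt
  obtain ⟨P, hP⟩ := isCompact_Icc.exists_bound_of_continuousOn hJcont
  have hP0 : 0 ≤ P := (norm_nonneg _).trans (hP 0 (left_mem_Icc.mpr hT))
  have hAcont : ContinuousOn (fun t => F' (u y t)) (Icc 0 T) :=
    hF'cont.comp (h.continuousOn hy) (fun t ht => h.mem y hy t ht)
  obtain ⟨M, hM⟩ := isCompact_Icc.exists_bound_of_continuousOn hAcont
  have hM0 : 0 ≤ M := (norm_nonneg _).trans (hM 0 (left_mem_Icc.mpr hT))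
  -- the Grönwall amplification factor
  set Q : ℝ := gronwallBound 0 M 1 T with hQ
  have hQ0 : 0 ≤ Q := by
    have := gronwallBound_mono (δ := 0) (K := M) (ε := 1) le_rfl zero_le_one hM0 hT
    rwa [gronwallBound_x0] at this
  set C : ℝ := Real.exp (K * T) with hC
  have hC0 : 0 < C := Real.exp_pos _
  -- the derivative estimate
  rw [hasFDerivWithinAt_iff_isLittleO, isLittleO_iff]
  intro ε hε
  -- (iii) uniform differentiability of `F` near `Γ`: choose `ε'` and `ρ`
  set ε' : ℝ := ε / (C * Q + 1) with hε'
  have hCQ : 0 < C * Q + 1 := by positivity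
  have hε'0 : 0 < ε' := div_pos hε hCQ
  obtain ⟨ρ₀, hρ₀, hρ₀F'⟩ := exists_forall_dist_lt_of_isCompact hF'cont hΓc hΓS hε'0
  set ρ : ℝ := min ρ₀ r₁ with hρ
  have hρ0 : 0 < ρ := lt_min hρ₀ hr₁
  have hunif : ∀ p ∈ Γ, ∀ q ∈ S, dist q p < ρ → ‖F q - F p - F' p (q - p)‖ ≤ ε' * ‖q - p‖ := by
    intro p hp q hq hqp
    have hconv : Convex ℝ (S ∩ ball p ρ) := hS.inter (convex_ball p ρ)
    have hpS : p ∈ S := hΓS hp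
    refine hconv.norm_image_sub_le_of_norm_hasFDerivWithin_le' (f := F) (f' := F')
      (fun z hz => (hFdiff z hz.1).mono inter_subset_left) (fun z hz => ?_)
      ⟨hpS, mem_ball_self hρ0⟩ ⟨hq, hqp⟩
    have := hρ₀F' p hp z hz.1 (lt_of_lt_of_le hz.2 (min_le_left _ _))
    rw [dist_eq_norm] at this
    exact this.le
  -- (ii) Lipschitz dependence and the tube of radius `ρ`
  have hlipρ : ∀ t ∈ Icc 0 T, LipschitzOnWith K F (S ∩ ball (u y t) ρ) := fun t ht =>
    (hlip (u y t) ⟨t, ht, rfl⟩).mono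
      (inter_subset_inter_right _ (ball_subset_ball (min_le_right _ _)))
  set δ : ℝ := ρ * Real.exp (-(K * T)) / 2 with hδ
  have hδ0 : 0 < δ := by positivity
  -- the eventual estimate
  rw [eventually_nhdsWithin_iff, Metric.eventually_nhds_iff]
  refine ⟨δ, hδ0, fun y' hy'δ hy' => ?_⟩
  have htube := h.dist_le_of_lipschitzOnWith_ball hρ0 hy hlipρ hy' hy'δ
  -- the error function `e` and its derivative
  set e : ℝ → E := fun t => u y' t - u y t - J t (y' - y) with he
  have he0 : e 0 = 0 := by
    simp only [he, h.init y hy, h.init y' hy', hJ0, one_apply_eq_self, sub_self]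
  have hederiv : ∀ t ∈ Ico 0 T, HasDerivWithinAt e
      (F (u y' t) - F (u y t) - (F' (u y t)).comp (J t) (y' - y)) (Ici t) t := by
    intro t ht
    have h1 := h.hasDerivWithinAt_Ici hy' ht
    have h2 := h.hasDerivWithinAt_Ici hy ht
    have h3 : HasDerivWithinAt (fun s => J s (y' - y)) ((F' (u y t)).comp (J t) (y' - y))
        (Ici t) t := by
      have hJ' := (hJ t (Ico_subset_Icc_self ht)).mono_of_mem_nhdsWithin
        (mem_of_superset (Icc_mem_nhdsGE ht.2) (Icc_subset_Icc ht.1 le_rfl))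
      have := hJ'.clm_apply (hasDerivWithinAt_const t (Ici t) (y' - y))
      simpa using this
    exact (h1.sub h2).sub h3
  have hecont : ContinuousOn e (Icc 0 T) := by
    refine ((h.continuousOn hy').sub (h.continuousOn hy)).sub ?_
    exact (ContinuousLinearMap.apply ℝ E (y' - y)).continuous.comp_continuousOn hJcont
  have hbound : ∀ t ∈ Ico 0 T,
      ‖F (u y' t) - F (u y t) - (F' (u y t)).comp (J t) (y' - y)‖ ≤
        M * ‖e t‖ + ε' * C * ‖y' - y‖ := by
    intro t ht
    have ht' := Ico_subset_Icc_self ht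
    have hmemΓ : u y t ∈ Γ := ⟨t, ht', rfl⟩
    have hq : u y' t ∈ S := h.mem y' hy' t ht'
    obtain ⟨hclose, hle⟩ := htube t ht'
    -- split the error
    have hsplit : F (u y' t) - F (u y t) - (F' (u y t)).comp (J t) (y' - y) =
        (F (u y' t) - F (u y t) - F' (u y t) (u y' t - u y t)) + F' (u y t) (e t) := by
      simp only [he, ContinuousLinearMap.comp_apply, map_sub]
      abel
    rw [hsplit]
    refine (norm_add_le _ _).trans ?_
    have hA : ‖F (u y' t) - F (u y t) - F' (u y t) (u y' t - u y t)‖ ≤ ε' * C * ‖y' - y‖ := by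
      refine (hunif _ hmemΓ _ hq hclose).trans ?_
      rw [mul_assoc]
      refine mul_le_mul_of_nonneg_left ?_ hε'0.le
      rw [← dist_eq_norm, ← dist_eq_norm, hC, mul_comm]
      exact hle
    have hB : ‖F' (u y t) (e t)‖ ≤ M * ‖e t‖ := (F' (u y t)).le_of_opNorm_le (hM t ht') _
    linarith
  have hgron := norm_le_gronwallBound_of_norm_deriv_right_le (f := e) hecont hederiv
    (by rw [he0, norm_zero]) hbound τ hτ
  -- evaluate the Grönwall bound
  have hfinal : gronwallBound 0 M (ε' * C * ‖y' - y‖) (τ - 0) ≤ ε * ‖y' - y‖ := by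
    rw [sub_zero, show ε' * C * ‖y' - y‖ = (ε' * C * ‖y' - y‖) * 1 by ring,
      gronwallBound_zero_mul]
    have hmono : gronwallBound 0 M 1 τ ≤ Q :=
      gronwallBound_mono (δ := 0) (K := M) (ε := 1) le_rfl zero_le_one hM0 hτ.2
    have hn : 0 ≤ ε' * C * ‖y' - y‖ := by positivity
    calc ε' * C * ‖y' - y‖ * gronwallBound 0 M 1 τ ≤ ε' * C * ‖y' - y‖ * Q :=
          mul_le_mul_of_nonneg_left hmono hn
      _ = ε * (C * Q / (C * Q + 1)) * ‖y' - y‖ := by rw [hε']; field_simp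
      _ ≤ ε * 1 * ‖y' - y‖ := by
          gcongr
          rw [div_le_one hCQ]; linarith
      _ = ε * ‖y' - y‖ := by ring
  simpa [he] using hgron.trans hfinal


/-- **Continuity of the linearisation in the initial value.** If along every trajectory of the
family `J y` solves the linearised equation `(J y)' = DF (u y t) ∘ J y`, `J y 0 = id`, then
`y ↦ J y τ` is continuous within `A` (continuous dependence of solutions of linear equations on
the coefficients, `norm_sub_le_of_linear`, plus uniform continuity of `DF` near the compact
trajectory; Lang 1995, IV §1, proof of Thm. 1.14, continuity of `D₂α`, p. 69). [cite: Lang1995, Ch. IV §1, Thm. 1.14 (proof, p. 69)] -/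
theorem continuousWithinAt_linearization (h : IsSolutionFamily F S A T u) (hT : 0 ≤ T)
    (hS : Convex ℝ S) (hSu : UniqueDiffOn ℝ S) (hF : ContDiffOn ℝ 1 F S)
    {J : E → ℝ → E →L[ℝ] E} (hJ0 : ∀ y ∈ A, J y 0 = 1)
    (hJ : ∀ y ∈ A, ∀ t ∈ Icc 0 T,
      HasDerivWithinAt (J y) ((fderivWithin ℝ F S (u y t)).comp (J y t)) (Icc 0 T) t)
    {y : E} (hy : y ∈ A) {τ : ℝ} (hτ : τ ∈ Icc 0 T) :
    ContinuousWithinAt (fun y' => J y' τ) A y := by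
  set F' : E → E →L[ℝ] E := fderivWithin ℝ F S with hF'def
  have hF'cont : ContinuousOn F' S := hF.continuousOn_fderivWithin hSu le_rfl
  set Γ : Set E := u y '' Icc 0 T with hΓ
  have hΓc : IsCompact Γ := h.isCompact_image hy
  have hΓS : Γ ⊆ S := h.image_subset hy
  obtain ⟨K, r₁, hr₁, hlip⟩ := exists_lipschitzOnWith_ball_of_isCompact hS hF hΓc hΓS
  have hAcont : ContinuousOn (fun t => F' (u y t)) (Icc 0 T) :=
    hF'cont.comp (h.continuousOn hy) (fun t ht => h.mem y hy t ht)
  obtain ⟨M, hM⟩ := isCompact_Icc.exists_bound_of_continuousOn hAcont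
  have hM0 : 0 ≤ M := (norm_nonneg _).trans (hM 0 (left_mem_Icc.mpr hT))
  -- a priori bound for `J y'` when the coefficients are within `1` of those of `y`
  set P : ℝ := ‖(1 : E →L[ℝ] E)‖ * Real.exp ((M + 1) * T) with hPdef
  have hP0 : 0 ≤ P := by positivity
  set Q : ℝ := gronwallBound 0 M 1 T with hQ
  have hQ0 : 0 ≤ Q := by
    have := gronwallBound_mono (δ := 0) (K := M) (ε := 1) le_rfl zero_le_one hM0 hT
    rwa [gronwallBound_x0] at this
  rw [Metric.continuousWithinAt_iff]
  intro ε hε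
  -- choose `η` with `η P Q < ε`, `η ≤ 1`
  set η : ℝ := min 1 (ε / (P * Q + 1)) with hηdef
  have hPQ : 0 < P * Q + 1 := by positivity
  have hη0 : 0 < η := lt_min one_pos (div_pos hε hPQ)
  have hη1 : η ≤ 1 := min_le_left _ _
  -- uniform continuity of `F'` near `Γ`
  obtain ⟨ρ₀, hρ₀, hρ₀F'⟩ := exists_forall_dist_lt_of_isCompact hF'cont hΓc hΓS hη0
  set ρ : ℝ := min ρ₀ r₁ with hρ
  have hρ0 : 0 < ρ := lt_min hρ₀ hr₁
  have hlipρ : ∀ t ∈ Icc 0 T, LipschitzOnWith K F (S ∩ ball (u y t) ρ) := fun t ht =>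
    (hlip (u y t) ⟨t, ht, rfl⟩).mono
      (inter_subset_inter_right _ (ball_subset_ball (min_le_right _ _)))
  set δ : ℝ := ρ * Real.exp (-(K * T)) / 2 with hδ
  have hδ0 : 0 < δ := by positivity
  refine ⟨δ, hδ0, fun y' hy' hy'δ => ?_⟩
  have htube := h.dist_le_of_lipschitzOnWith_ball hρ0 hy hlipρ hy' hy'δ
  -- the coefficients along `y'` are `η`-close to those along `y`
  have hcoef : ∀ t ∈ Ico 0 T, ‖F' (u y t) - F' (u y' t)‖ ≤ η := by
    intro t ht
    have ht' := Ico_subset_Icc_self ht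
    have := hρ₀F' (u y t) ⟨t, ht', rfl⟩ (u y' t) (h.mem y' hy' t ht')
      (lt_of_lt_of_le (htube t ht').1 (min_le_left _ _))
    rw [dist_eq_norm, norm_sub_rev] at this
    exact this.le
  -- a priori bound on `J y'`
  have hJ'bound : ∀ t ∈ Ico 0 T, ‖J y' t‖ ≤ P := by
    intro t ht
    have hM' : ∀ s ∈ Ico 0 T, ‖F' (u y' s)‖ ≤ M + 1 := by
      intro s hs
      have h1 := hM s (Ico_subset_Icc_self hs)
      have h2 := hcoef s hs
      calc ‖F' (u y' s)‖ = ‖F' (u y s) - (F' (u y s) - F' (u y' s))‖ := by rw [sub_sub_cancel]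
        _ ≤ ‖F' (u y s)‖ + ‖F' (u y s) - F' (u y' s)‖ := norm_sub_le _ _
        _ ≤ M + 1 := add_le_add h1 (h2.trans hη1)
    have := norm_le_of_linear (A := fun s => (F' (u y' s))) (hJ y' hy') hM' t
      (Ico_subset_Icc_self ht)
    rw [hJ0 y' hy', sub_zero] at this
    refine this.trans ?_
    rw [hPdef]
    have hMt : (M + 1) * t ≤ (M + 1) * T := mul_le_mul_of_nonneg_left ht.2.le (by linarith)
    gcongr
  have key := norm_sub_le_of_linear (A₁ := fun s => F' (u y s)) (A₂ := fun s => F' (u y' s))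
    (hJ y hy) (hJ y' hy') (fun t ht => hM t (Ico_subset_Icc_self ht)) hcoef hJ'bound hη0.le τ hτ
  rw [hJ0 y hy, hJ0 y' hy', sub_self, norm_zero, sub_zero] at key
  rw [dist_eq_norm, norm_sub_rev]
  refine lt_of_le_of_lt key ?_
  rw [show η * P = (η * P) * 1 by ring, gronwallBound_zero_mul]
  have hmono : gronwallBound 0 M 1 τ ≤ Q :=
    gronwallBound_mono (δ := 0) (K := M) (ε := 1) le_rfl zero_le_one hM0 hτ.2
  calc η * P * gronwallBound 0 M 1 τ ≤ η * P * Q :=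
        mul_le_mul_of_nonneg_left hmono (by positivity)
    _ ≤ ε / (P * Q + 1) * P * Q := by
        have : η ≤ ε / (P * Q + 1) := min_le_right _ _
        have hPQ' : 0 ≤ P * Q := by positivity
        nlinarith
    _ = ε * (P * Q / (P * Q + 1)) := by field_simp
    _ < ε * 1 := by
        refine mul_lt_mul_of_pos_left ?_ hε
        rw [div_lt_one hPQ]; linarith
    _ = ε := mul_one ε


/-- The linearised equation along every trajectory of a solution family has a solution with
`J y 0 = id` (for `F` of class `C¹` on `S`, Banach `E`; `exists_solution_linear`). [folklore] -/
theorem exists_linearization [CompleteSpace E] (h : IsSolutionFamily F S A T u) (hT : 0 ≤ T)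
    (hSu : UniqueDiffOn ℝ S) (hF : ContDiffOn ℝ 1 F S) :
    ∃ J : E → ℝ → E →L[ℝ] E, (∀ y ∈ A, J y 0 = 1) ∧ ∀ y ∈ A, ∀ t ∈ Icc 0 T,
      HasDerivWithinAt (J y) ((fderivWithin ℝ F S (u y t)).comp (J y t)) (Icc 0 T) t := by
  have hF'cont : ContinuousOn (fderivWithin ℝ F S) S := hF.continuousOn_fderivWithin hSu le_rfl
  have hex : ∀ y ∈ A, ∃ J : ℝ → E →L[ℝ] E, J 0 = 1 ∧ ∀ t ∈ Icc 0 T,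
      HasDerivWithinAt J ((fderivWithin ℝ F S (u y t)).comp (J t)) (Icc 0 T) t := by
    intro y hy
    exact exists_solution_linear (A := fun t => fderivWithin ℝ F S (u y t)) hT
      (hF'cont.comp (h.continuousOn hy) (fun t ht => h.mem y hy t ht)) 1
  choose! J hJ0 hJ using hex
  exact ⟨J, hJ0, hJ⟩

/-- **`C^k` dependence on the initial value** for families of solutions on `[0, T]` staying in a
convex set `S` on which the field is `C^k`, `k ≥ 1` (induction on `k` through the linearised
system `(u, J)`, which is a solution family of the `C^{k-1}` field `(x, B) ↦ (F x, DF x ∘ B)`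
on `S × (E →L E)`, all Banach spaces of one universe being quantified in the induction;
Lang 1995, IV §1, proof of Thm. 1.14, p. 70: "by induction, `D₂α` is of class `C^{p-1}` since
`Df` is of class `C^{p-1}`"; Hartman 1964, Ch. V, Cor. 3.1 / Thm. 4.1). [cite: Lang1995, Ch. IV §1, Thm. 1.14] -/
theorem contDiffOn_succ : ∀ (k : ℕ) {E : Type u} [NormedAddCommGroup E] [NormedSpace ℝ E]
    [CompleteSpace E] {F : E → E} {S A : Set E} {T : ℝ} {u : E → ℝ → E}
    (_h : IsSolutionFamily F S A T u) (_hT : 0 ≤ T) (_hS : Convex ℝ S) (_hSu : UniqueDiffOn ℝ S)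
    (_hA : UniqueDiffOn ℝ A) (_hF : ContDiffOn ℝ (k + 1 : ℕ) F S) {τ : ℝ} (_hτ : τ ∈ Icc 0 T),
    ContDiffOn ℝ (k + 1 : ℕ) (fun y => u y τ) A := by
  intro k
  induction k with
  | zero =>
    intro E _ _ _ F S A T u h hT hS hSu hA hF τ hτ
    have hF1 : ContDiffOn ℝ 1 F S := hF
    obtain ⟨J, hJ0, hJ⟩ := h.exists_linearization hT hSu hF1
    have hderiv : ∀ y ∈ A, HasFDerivWithinAt (fun y' => u y' τ) (J y τ) A y := fun y hy =>
      h.hasFDerivWithinAt hT hS hSu hF1 hy (hJ0 y hy) (hJ y hy) hτ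
    have hfd : ∀ y ∈ A, fderivWithin ℝ (fun y' => u y' τ) A y = J y τ := fun y hy =>
      (hderiv y hy).fderivWithin (hA y hy)
    rw [show ((0 + 1 : ℕ) : WithTop ℕ∞) = 0 + 1 by norm_num, contDiffOn_succ_iff_fderivWithin hA]
    refine ⟨fun y hy => (hderiv y hy).differentiableWithinAt, fun h0 => absurd h0 (by simp), ?_⟩
    rw [contDiffOn_zero]
    refine ContinuousOn.congr (f := fun y => J y τ) (fun y hy => ?_) hfd
    exact h.continuousWithinAt_linearization hT hS hSu hF1 hJ0 hJ hy hτ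
  | succ k IH =>
    intro E _ _ _ F S A T u h hT hS hSu hA hF τ hτ
    have hF1 : ContDiffOn ℝ 1 F S := hF.of_le (by norm_cast; omega)
    obtain ⟨J, hJ0, hJ⟩ := h.exists_linearization hT hSu hF1
    have hderiv : ∀ y ∈ A, HasFDerivWithinAt (fun y' => u y' τ) (J y τ) A y := fun y hy =>
      h.hasFDerivWithinAt hT hS hSu hF1 hy (hJ0 y hy) (hJ y hy) hτ
    have hfd : ∀ y ∈ A, fderivWithin ℝ (fun y' => u y' τ) A y = J y τ := fun y hy =>
      (hderiv y hy).fderivWithin (hA y hy)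
    -- the derivative `F'` is `C^{k+1}` on `S`
    set F' : E → E →L[ℝ] E := fderivWithin ℝ F S with hF'def
    have hF' : ContDiffOn ℝ (k + 1 : ℕ) F' S := by
      have := ((contDiffOn_succ_iff_fderivWithin hSu).1
        (show ContDiffOn ℝ ((k + 1 : ℕ) + 1) F S by exact_mod_cast hF)).2.2
      exact this
    -- the extended system on `E × (E →L E)`
    let E' := E × (E →L[ℝ] E)
    set G : E' → E' := fun q => (F q.1, (F' q.1).comp q.2) with hGdef
    set u' : E' → ℝ → E' := fun q t => (u q.1 t, (J q.1 t).comp q.2) with hu'def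
    have hG : ContDiffOn ℝ (k + 1 : ℕ) G (S ×ˢ (univ : Set (E →L[ℝ] E))) := by
      have h1 : ContDiffOn ℝ (k + 1 : ℕ) (fun q : E' => F q.1) (S ×ˢ univ) :=
        (hF.of_le (by norm_cast; omega)).comp contDiffOn_fst (fun q hq => hq.1)
      have h2 : ContDiffOn ℝ (k + 1 : ℕ) (fun q : E' => F' q.1) (S ×ˢ univ) :=
        hF'.comp contDiffOn_fst (fun q hq => hq.1)
      exact h1.prodMk (h2.clm_comp contDiffOn_snd)
    have h' : IsSolutionFamily G (S ×ˢ (univ : Set (E →L[ℝ] E))) (A ×ˢ univ) T u' := by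
      refine ⟨fun q hq => ?_, fun q hq t ht => ?_,
        fun q hq t ht => ⟨h.mem q.1 hq.1 t ht, mem_univ _⟩⟩
      · change (u q.1 0, (J q.1 0).comp q.2) = q
        rw [h.init q.1 hq.1, hJ0 q.1 hq.1, ContinuousLinearMap.one_def, ContinuousLinearMap.id_comp]
      · have hd1 := h.hasDerivWithinAt q.1 hq.1 t ht
        have hd2 : HasDerivWithinAt (fun s => (J q.1 s).comp q.2)
            (((F' (u q.1 t)).comp (J q.1 t)).comp q.2) (Icc 0 T) t := by
          have := (hJ q.1 hq.1 t ht).clm_comp (hasDerivWithinAt_const t (Icc 0 T) q.2)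
          simpa using this
        have := hd1.prodMk hd2
        change HasDerivWithinAt (fun s => (u q.1 s, (J q.1 s).comp q.2))
          (F (u q.1 t), (F' (u q.1 t)).comp ((J q.1 t).comp q.2)) (Icc 0 T) t
        rw [← ContinuousLinearMap.comp_assoc]
        exact this
    have IH' := IH (E := E') h' hT (hS.prod convex_univ) (hSu.prod uniqueDiffOn_univ)
      (hA.prod uniqueDiffOn_univ) hG hτ
    -- read off smoothness of `y ↦ J y τ`
    have hJsmooth : ContDiffOn ℝ (k + 1 : ℕ) (fun y => J y τ) A := by
      have hι : ContDiffOn ℝ (k + 1 : ℕ) (fun y : E => ((y, (1 : E →L[ℝ] E)) : E')) A :=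
        contDiffOn_id.prodMk contDiffOn_const
      have hcomp := (IH'.comp hι (fun y hy => ⟨hy, mem_univ _⟩)).snd
      refine hcomp.congr (fun y hy => ?_)
      change J y τ = (J y τ).comp 1
      rw [ContinuousLinearMap.one_def, ContinuousLinearMap.comp_id]
    rw [show (((k + 1) + 1 : ℕ) : WithTop ℕ∞) = ((k + 1 : ℕ) : WithTop ℕ∞) + 1 by push_cast; ring,
      contDiffOn_succ_iff_fderivWithin hA]
    refine ⟨fun y hy => (hderiv y hy).differentiableWithinAt, fun h0 => absurd h0 (by simp), ?_⟩
    exact hJsmooth.congr hfd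

/-- **`C^n` dependence on the initial value**, `1 ≤ n ≤ ∞`: for a family of solutions of
`u' = F (u)` on `[0, T]` with values in the convex set `S`, `F ∈ C^n(S)`, and initial values
ranging over a set `A` with unique derivatives, each `y ↦ u y τ` is `C^n` on `A`
(Lang 1995, IV §1, Thm. 1.14, `p ≤ ∞`, in the within-a-convex-set form). [cite: Lang1995, Ch. IV §1, Thm. 1.14] -/
theorem contDiffOn {E : Type u} [NormedAddCommGroup E] [NormedSpace ℝ E] [CompleteSpace E]
    {F : E → E} {S A : Set E} {T : ℝ} {u : E → ℝ → E} (h : IsSolutionFamily F S A T u)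
    (hT : 0 ≤ T) (hS : Convex ℝ S) (hSu : UniqueDiffOn ℝ S) (hA : UniqueDiffOn ℝ A) {n : ℕ∞}
    (hn : 1 ≤ n) (hF : ContDiffOn ℝ n F S) {τ : ℝ} (hτ : τ ∈ Icc 0 T) :
    ContDiffOn ℝ n (fun y => u y τ) A := by
  induction n using ENat.recTopCoe with
  | top =>
    rw [show ((⊤ : ℕ∞) : WithTop ℕ∞) = ∞ from rfl, contDiffOn_infty] at hF ⊢
    intro m
    exact (contDiffOn_succ m h hT hS hSu hA (hF (m + 1)) hτ).of_le (by norm_cast; omega)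
  | coe k =>
    obtain ⟨k', rfl⟩ : ∃ k', k = k' + 1 :=
      Nat.exists_eq_add_one_of_ne_zero (by rintro rfl; exact absurd hn (by norm_num))
    exact contDiffOn_succ k' h hT hS hSu hA (by exact_mod_cast hF) hτ

end IsSolutionFamily

end Family

/-! ## Flows within a convex set: joint smoothness in space and time -/

section Flow

universe u

variable {E : Type u} [NormedAddCommGroup E] [NormedSpace ℝ E]

/-- For `s ∈ [0, 1]`, `c s` lies between `0` and `c`. [folklore] -/
theorem mul_mem_uIcc_of_mem_Icc {c s : ℝ} (hs : s ∈ Icc (0 : ℝ) 1) : c * s ∈ uIcc 0 c := by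
  rcases le_or_gt 0 c with hc | hc
  · rw [uIcc_of_le hc]
    exact ⟨mul_nonneg hc hs.1, by nlinarith [hs.2]⟩
  · rw [uIcc_of_ge hc.le]
    exact ⟨by nlinarith [hs.2], mul_nonpos_of_nonpos_of_nonneg hc.le hs.1⟩

/-- A (partial) **flow of `F` within `S`** on `Ω ⊆ E × ℝ`: for every `(x, t) ∈ Ω` the curve
`φ x` starts at `x`, solves `u' = F (u)` on the closed interval between `0` and `t` (one-sided
derivatives at the ends) and stays in `S` there.  No openness of `Ω` and no maximality are
required; on a manifold with boundary, `S` is the closed half-space chart range (Lang 1995,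
IV §1, the flow `α : 𝔇(f) → U` on its domain of definition, p. 70; Hirsch 1976, §6.2, flows of
vector fields on `∂`-manifolds). [cite: Lang1995, Ch. IV §1, p. 70 (flow and its domain of definition)] -/
structure IsFlowWithin (F : E → E) (S : Set E) (φ : E → ℝ → E) (Ω : Set (E × ℝ)) : Prop where
  init : ∀ p ∈ Ω, φ p.1 0 = p.1
  hasDerivWithinAt : ∀ p ∈ Ω, ∀ t ∈ uIcc 0 p.2,
    HasDerivWithinAt (φ p.1) (F (φ p.1 t)) (uIcc 0 p.2) t
  mem : ∀ p ∈ Ω, ∀ t ∈ uIcc 0 p.2, φ p.1 t ∈ S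

/-- **Flows within a convex set are smooth in space and time.**  If `F` is `C^n` on the convex
set `S` (`1 ≤ n ≤ ∞`) and `φ` is a flow of `F` within `S` on `Ω`, then `(x, t) ↦ φ x t` is
`C^n` on `Ω` (derivatives within `Ω`, assumed to have the unique differentiability property).
Reduction to `IsSolutionFamily.contDiffOn` by rescaling time: `s ↦ (φ x (t s), t)` is the
solution family on `[0, 1]`, indexed by `(x, t) ∈ Ω`, of the field `(x, t) ↦ (t • F x, 0)`
(Lang 1995, IV §1, Thm. 1.16 "Global smoothness of the flow", here within a convex set and
without maximality of the domain; Hirsch 1976, §6.2). [cite: Lang1995, Ch. IV §1, Thm. 1.16] -/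
theorem IsFlowWithin.contDiffOn [CompleteSpace E] {F : E → E} {S : Set E} {φ : E → ℝ → E}
    {Ω : Set (E × ℝ)} (h : IsFlowWithin F S φ Ω) (hS : Convex ℝ S) (hSu : UniqueDiffOn ℝ S)
    (hΩ : UniqueDiffOn ℝ Ω) {n : ℕ∞} (hn : 1 ≤ n) (hF : ContDiffOn ℝ n F S) :
    ContDiffOn ℝ n (fun p : E × ℝ => φ p.1 p.2) Ω := by
  let E' := E × ℝ
  set G : E' → E' := fun q => (q.2 • F q.1, 0) with hGdef
  set u : E' → ℝ → E' := fun q s => (φ q.1 (q.2 * s), q.2) with hudef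
  have hG : ContDiffOn ℝ n G (S ×ˢ (univ : Set ℝ)) := by
    have h1 : ContDiffOn ℝ n (fun q : E' => F q.1) (S ×ˢ univ) :=
      hF.comp contDiffOn_fst (fun q hq => hq.1)
    exact (contDiffOn_snd.smul h1).prodMk contDiffOn_const
  have hu : IsSolutionFamily G (S ×ˢ (univ : Set ℝ)) Ω 1 u := by
    refine ⟨fun q hq => ?_, fun q hq s hs => ?_,
      fun q hq s hs => ⟨h.mem q hq _ (mul_mem_uIcc_of_mem_Icc hs), mem_univ _⟩⟩
    · change (φ q.1 (q.2 * 0), q.2) = q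
      rw [mul_zero, h.init q hq]
    · have hφ := h.hasDerivWithinAt q hq (q.2 * s) (mul_mem_uIcc_of_mem_Icc hs)
      have hlin : HasDerivWithinAt (fun s : ℝ => q.2 * s) (q.2 * 1) (Icc 0 1) s :=
        (hasDerivWithinAt_id s _).const_mul q.2
      have hcomp := hφ.scomp s hlin (fun s' hs' => mul_mem_uIcc_of_mem_Icc hs')
      have h2 : HasDerivWithinAt (fun _ : ℝ => q.2) 0 (Icc 0 1) s := hasDerivWithinAt_const s _ _
      have := hcomp.prodMk h2
      simpa [Function.comp_def] using this
  have key := hu.contDiffOn zero_le_one (hS.prod convex_univ) (hSu.prod uniqueDiffOn_univ) hΩ hn hG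
    (τ := 1) ⟨zero_le_one, le_rfl⟩
  refine (key.fst).congr (fun q hq => ?_)
  simp [hudef]

end Flow

end Literature.Analysis.ODE
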